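import Literature.AlgebraicGeometry.Resolution.IdealKernelPeeling
import HarnessLib

/-!
# Multiplication by a global function: `𝓛/𝓛𝓘 ≅ g𝓛/g𝓛𝓘` (Lipman 1969, §13 — moving the curve `E` by `div g`)

Topic: `Literature/AlgebraicGeometry/Resolution`.  PROVED, fact-free, definition-free.  In the computation of the
conormal degrees `χ(𝓘_E^n/𝓘_E^{n+1})` on a resolution (J. Lipman, *Rational singularities …*, Publ. Math. IHÉS 36
(1969), §13 p. 223 with §12 Remark 2 c) p. 221, and Mumford's `e·div(π^*f) ∼ D' + Σ b_j E_j`, §14 p. 224) one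
replaces the invertible ideal `𝓛` by `g𝓛 = 𝓖𝓛`, `𝓖 = (g) = 𝓘_E^a 𝓗` the ideal of a global function `g`:
multiplication by `g` is an ISOMORPHISM of `𝒪_X`-modules

  `K(𝓛; 𝓘) = 𝓛/𝓛𝓘  ⥲  K(𝓖𝓛; 𝓘) = 𝓖𝓛/𝓖𝓛𝓘`   (`K(𝓐;𝓑) := ker(𝒪/𝓐𝓑 → 𝒪/𝓐)`),

for any ideal sheaves `𝓛`, `𝓘` and any ideal sheaf `𝓖` with `𝓖(V) = (g|_V)` on affine opens, `g|_V` a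
non-zero-divisor.  Hence `ℓ_T Γ` and `ℓ_T Ȟ¹(𝒰, –)` of the two kernels agree — the invariance half of the
self-intersection step (the other half is the peeling identity of `Resolution/IdealKernelPeeling` applied to
`𝓖𝓛 = (𝓛𝓘_E^a)𝓗`).

* `idealQuotScalarMul_sq` — the square `𝒪/𝓛𝓘 → 𝒪/𝓛` / `𝒪/𝓖𝓛𝓘 → 𝒪/𝓖𝓛` under multiplication by `g` commutes;
* `mono_kernel_map_scalarMul`, `epi_kernel_map_scalarMul`, **`isIso_kernel_map_scalarMul`**;
* **`length_kernel_scalarMul_eq`** — `ℓΓ(K(𝓖𝓛;𝓘)) = ℓΓ(K(𝓛;𝓘))` and `ℓȞ¹(𝒰, K(𝓖𝓛;𝓘)) = ℓȞ¹(𝒰, K(𝓛;𝓘))`.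

The multiplication maps `μ : 𝒪/𝓙 → 𝒪/𝓙'` (`g𝓙 ⊆ 𝓙'`) are taken as data with their defining property
`(𝒪 → 𝒪/𝓙) ≫ μ = (g·) ≫ (𝒪 → 𝒪/𝓙')`; `idealMulι_globalScalar_idealQuotπ` shows they exist (`cokernel.desc`).

## References
* J. Lipman, Publ. Math. IHÉS 36 (1969), §13 (p. 223), §12 Remark 2 c) (p. 221), §14 (p. 224). [Lipman1969]
* The Stacks Project, Tag 01CL (modules `𝒥M`, `M/𝒥M`). [StacksProject]
-/

noncomputable section

-- `TopCat.Presheaf`/`Scheme.Modules` are not reducible (as in Mathlib's `AlgebraicGeometry/Modules`).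
set_option backward.isDefEq.respectTransparency false

open CategoryTheory CategoryTheory.Limits AlgebraicGeometry TopologicalSpace IsLocalRing Opposite
open Literature.AlgebraicGeometry.Morphisms Literature.AlgebraicGeometry.Modules
open Literature.AlgebraicGeometry.Motives
open Scheme.IdealSheafData

universe u

namespace Literature.AlgebraicGeometry.Resolution

variable {T : Type u} [CommRing T] {X : Scheme.{u}} (π : X ⟶ Spec (.of T))

/-- `(φ ≫ ψ)_V(x) = ψ_V(φ_V(x))` on sections of `𝒪_X`-modules. [folklore] -/
private theorem comp_app_apply'' {M N P : X.Modules} (φ : M ⟶ N) (ψ : N ⟶ P) (V : X.Opens) (x : Γ(M, V)) :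
    (φ ≫ ψ).app V x = ψ.app V (φ.app V x) := by
  rw [Scheme.Modules.Hom.comp_app, CategoryTheory.comp_apply]

/-- Naturality of `φ.app` on sections. [folklore] -/
private theorem app_map_apply'' {M N : X.Modules} (φ : M ⟶ N) {U V : X.Opens} (i : U ⟶ V) (y : Γ(M, V)) :
    φ.app U (M.presheaf.map i.op y) = N.presheaf.map i.op (φ.app V y) :=
  ConcreteCategory.congr_hom (φ.mapPresheaf.naturality i.op) y

/-! ## §1 Multiplication by a global function on quotients `𝒪/𝓙 → 𝒪/𝓙'` -/

section Mul

variable (γ : Γ(X, ⊤)) (𝓙 𝓙' : X.IdealSheafData)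

/-- **`g·𝓙 ⊆ 𝓙'` ⇒ `𝓙𝒪 → 𝒪 → 𝒪/𝓙'`, `s ↦ g s`, vanishes** (so that multiplication by `g` descends to
`𝒪/𝓙 → 𝒪/𝓙'`, `cokernel.desc`). [cite: StacksProject, Tag 01CL] -/
theorem idealMulι_globalScalar_idealQuotπ
    (hγ : ∀ (V : X.affineOpens) (s : Γ(X, V)), s ∈ 𝓙.ideal V →
      X.presheaf.map (homOfLE (le_top : (V : X.Opens) ≤ ⊤)).op γ * s ∈ 𝓙'.ideal V) :
    idealMulι (unitModule X) 𝓙 ≫ globalScalar (unitModule X) γ ≫ idealQuotπ (unitModule X) 𝓙' = 0 := by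
  refine Scheme.Modules.hom_ext _ _ fun U => ?_
  ext s
  change (globalScalar (unitModule X) γ ≫ idealQuotπ (unitModule X) 𝓙').app U
    ((idealMulι (unitModule X) 𝓙).app U s) = 0
  rw [comp_app_apply'']
  refine section_eq_zero_of_locally _ _ fun x hx => ?_
  obtain ⟨V, hV, hxV, hmem⟩ := isIdealMulSection_idealMulι_app (unitModule X) 𝓙 U s x hx
  refine ⟨V, hV, hxV, ?_⟩
  rw [← app_map_apply'', ← app_map_apply'', globalScalar_app_apply, idealQuotπ_unit_app_eq_zero_iff _ V.2]
  have hs := (mem_ideal_smul_top_unitModule_iff 𝓙 V _).mp hmem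
  have hVV : X.presheaf.map (homOfLE (le_top : (V : X.Opens) ≤ ⊤)).op γ •
      (unitModule X).presheaf.map (homOfLE hV).op ((idealMulι (unitModule X) 𝓙).app U s) =
      (show Γ(unitModule X, V) from
        (X.presheaf.map (homOfLE (le_top : (V : X.Opens) ≤ ⊤)).op γ *
          (show Γ(X, V) from (unitModule X).presheaf.map (homOfLE hV).op
            ((idealMulι (unitModule X) 𝓙).app U s)))) := rfl
  rw [hVV]
  exact hγ V _ hs

variable (μ : idealQuot (unitModule X) 𝓙 ⟶ idealQuot (unitModule X) 𝓙')
  (hμ : idealQuotπ (unitModule X) 𝓙 ≫ μ = globalScalar (unitModule X) γ ≫ idealQuotπ (unitModule X) 𝓙')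

include hμ in
/-- Sections of the multiplication map: `μ(class of c) = class of g|_V · c`. [cite: StacksProject, Tag 01CL] -/
theorem scalarMul_app_idealQuotπ_app (V : X.Opens) (c : Γ(unitModule X, V)) :
    μ.app V ((idealQuotπ (unitModule X) 𝓙).app V c) =
      (idealQuotπ (unitModule X) 𝓙').app V
        (show Γ(unitModule X, V) from
          (X.presheaf.map (homOfLE (le_top : V ≤ ⊤)).op γ * (show Γ(X, V) from c))) := by
  rw [← comp_app_apply'', hμ, comp_app_apply'', globalScalar_app_apply]
  rfl

end Mul

/-! ## §2 The isomorphism `𝓛/𝓛𝓘 ⥲ 𝓖𝓛/𝓖𝓛𝓘` -/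

section Iso

variable (γ : Γ(X, ⊤)) (𝓖 𝓛 𝓘 : X.IdealSheafData)
  (hG : ∀ V : X.affineOpens, 𝓖.ideal V = Ideal.span {X.presheaf.map (homOfLE (le_top : (V : X.Opens) ≤ ⊤)).op γ})
  (hγ : ∀ V : X.affineOpens, X.presheaf.map (homOfLE (le_top : (V : X.Opens) ≤ ⊤)).op γ ∈ nonZeroDivisors Γ(X, V))
  (q : idealQuot (unitModule X) (𝓛 * 𝓘) ⟶ idealQuot (unitModule X) 𝓛)
  (hq : idealQuotπ (unitModule X) (𝓛 * 𝓘) ≫ q = idealQuotπ (unitModule X) 𝓛)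
  (q' : idealQuot (unitModule X) (𝓖 * 𝓛 * 𝓘) ⟶ idealQuot (unitModule X) (𝓖 * 𝓛))
  (hq' : idealQuotπ (unitModule X) (𝓖 * 𝓛 * 𝓘) ≫ q' = idealQuotπ (unitModule X) (𝓖 * 𝓛))
  (μ₁ : idealQuot (unitModule X) (𝓛 * 𝓘) ⟶ idealQuot (unitModule X) (𝓖 * 𝓛 * 𝓘))
  (hμ₁ : idealQuotπ (unitModule X) (𝓛 * 𝓘) ≫ μ₁ =
    globalScalar (unitModule X) γ ≫ idealQuotπ (unitModule X) (𝓖 * 𝓛 * 𝓘))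
  (μ₂ : idealQuot (unitModule X) 𝓛 ⟶ idealQuot (unitModule X) (𝓖 * 𝓛))
  (hμ₂ : idealQuotπ (unitModule X) 𝓛 ≫ μ₂ = globalScalar (unitModule X) γ ≫ idealQuotπ (unitModule X) (𝓖 * 𝓛))
  (w : q ≫ μ₂ = μ₁ ≫ q')

include hG in
/-- `g · 𝓙(V) ⊆ (𝓖𝓙)(V)` on affine opens, for `𝓖(V) = (g|_V)`. [folklore] -/
private theorem mul_mem_ideal_mul (𝓙 : X.IdealSheafData) (V : X.affineOpens) (s : Γ(X, V)) (hs : s ∈ 𝓙.ideal V) :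
    X.presheaf.map (homOfLE (le_top : (V : X.Opens) ≤ ⊤)).op γ * s ∈ (𝓖 * 𝓙).ideal V := by
  rw [ideal_mul, Pi.mul_apply, hG V]
  exact Ideal.mul_mem_mul (Ideal.mem_span_singleton_self _) hs

include hG in
/-- The multiplication maps exist: `g(𝓛𝓘) ⊆ 𝓖𝓛𝓘`. [cite: StacksProject, Tag 01CL] -/
theorem idealMulι_globalScalar_idealQuotπ_mul₁ :
    idealMulι (unitModule X) (𝓛 * 𝓘) ≫ globalScalar (unitModule X) γ ≫
      idealQuotπ (unitModule X) (𝓖 * 𝓛 * 𝓘) = 0 :=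
  idealMulι_globalScalar_idealQuotπ γ _ _ fun V s hs => by
    rw [mul_assoc]
    exact mul_mem_ideal_mul γ 𝓖 hG (𝓛 * 𝓘) V s hs

include hG in
/-- The multiplication maps exist: `g𝓛 ⊆ 𝓖𝓛`. [cite: StacksProject, Tag 01CL] -/
theorem idealMulι_globalScalar_idealQuotπ_mul₂ :
    idealMulι (unitModule X) 𝓛 ≫ globalScalar (unitModule X) γ ≫ idealQuotπ (unitModule X) (𝓖 * 𝓛) = 0 :=
  idealMulι_globalScalar_idealQuotπ γ _ _ fun V s hs => mul_mem_ideal_mul γ 𝓖 hG 𝓛 V s hs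

include hq hq' hμ₁ hμ₂ in
/-- **The square commutes**: `(𝒪/𝓛𝓘 → 𝒪/𝓛) ≫ (g·) = (g·) ≫ (𝒪/𝓖𝓛𝓘 → 𝒪/𝓖𝓛)`. [cite: StacksProject, Tag 01CL] -/
theorem idealQuotScalarMul_sq : q ≫ μ₂ = μ₁ ≫ q' := by
  apply idealQuot_hom_ext
  rw [← Category.assoc, hq, hμ₂, ← Category.assoc, hμ₁, Category.assoc, hq']

include hG hγ hμ₁ in
/-- **`K(𝓛;𝓘) → K(𝓖𝓛;𝓘)` is a monomorphism**: on an affine `V`, if `g c ∈ (𝓖𝓛𝓘)(V) = g·(𝓛𝓘)(V)` then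
`c ∈ (𝓛𝓘)(V)`, `g|_V` being a non-zero-divisor. [cite: Lipman1969, Section 13 (p. 223)] -/
theorem mono_kernel_map_scalarMul : Mono (kernel.map q q' μ₁ μ₂ w) := by
  refine mono_of_injective_app_of_isAffineOpen _ fun V hV => ?_
  intro s s' hss'
  rw [← sub_eq_zero]
  rw [← sub_eq_zero, ← map_sub] at hss'
  generalize s - s' = t at hss' ⊢
  apply kernel_ι_app_injective q V
  rw [map_zero]
  obtain ⟨c, hc⟩ := idealQuotπ_unit_app_surjective (𝓛 * 𝓘) hV ((kernel.ι q).app V t)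
  have h1 : (kernel.ι q').app V ((kernel.map q q' μ₁ μ₂ w).app V t) = μ₁.app V ((kernel.ι q).app V t) := by
    rw [← comp_app_apply'', kernel.lift_ι, comp_app_apply'']
  have h2 : μ₁.app V ((kernel.ι q).app V t) = 0 := by rw [← h1, hss', map_zero]
  rw [← hc, scalarMul_app_idealQuotπ_app γ _ _ μ₁ hμ₁ V c, idealQuotπ_unit_app_eq_zero_iff _ hV] at h2
  -- `g c ∈ (𝓖𝓛𝓘)(V) = (g) (𝓛𝓘)(V)`
  have h3 : X.presheaf.map (homOfLE (le_top : V ≤ ⊤)).op γ * (show Γ(X, V) from c) ∈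
      Ideal.span {X.presheaf.map (homOfLE (le_top : V ≤ ⊤)).op γ} * (𝓛 * 𝓘).ideal ⟨V, hV⟩ := by
    have e : (𝓖 * 𝓛 * 𝓘).ideal ⟨V, hV⟩ =
        Ideal.span {X.presheaf.map (homOfLE (le_top : V ≤ ⊤)).op γ} * (𝓛 * 𝓘).ideal ⟨V, hV⟩ := by
      rw [mul_assoc, ideal_mul, Pi.mul_apply, hG ⟨V, hV⟩]
    rw [← e]
    exact h2
  rw [Ideal.mem_span_singleton_mul] at h3
  obtain ⟨z, hz, hzc⟩ := h3
  have hzc' : z = (show Γ(X, V) from c) := (mul_cancel_left_mem_nonZeroDivisors (hγ ⟨V, hV⟩)).mp hzc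
  rw [← hc, idealQuotπ_unit_app_eq_zero_iff _ hV]
  rw [← hzc']
  exact hz

include hG hq hq' hμ₁ in
/-- **`K(𝓛;𝓘) → K(𝓖𝓛;𝓘)` is an epimorphism**: on an affine `V` a section of `K(𝓖𝓛;𝓘)` is the class of some
`c' ∈ (𝓖𝓛)(V) = g·𝓛(V)`, `c' = g c`, the image of the section of `K(𝓛;𝓘)` defined by `c`.
[cite: Lipman1969, Section 13 (p. 223)] -/
theorem epi_kernel_map_scalarMul : Epi (kernel.map q q' μ₁ μ₂ w) := by
  refine epi_of_surjective_app_of_isAffineOpen _ fun V hV => ?_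
  intro u
  obtain ⟨c', hc'⟩ := idealQuotπ_unit_app_surjective (𝓖 * 𝓛 * 𝓘) hV ((kernel.ι q').app V u)
  have h1 : (show Γ(X, V) from c') ∈ (𝓖 * 𝓛).ideal ⟨V, hV⟩ := by
    rw [← idealQuotπ_unit_app_eq_zero_iff _ hV, ← app_idealQuotπ_app_of_comp_eq hq' V c', hc']
    exact app_kernel_ι_app q' V u
  rw [ideal_mul, Pi.mul_apply, hG ⟨V, hV⟩, Ideal.mem_span_singleton_mul] at h1
  obtain ⟨c, hcL, hcc'⟩ := h1
  -- the section of `K(𝓛;𝓘)` defined by `c`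
  have h2 : q.app V ((idealQuotπ (unitModule X) (𝓛 * 𝓘)).app V (show Γ(unitModule X, V) from c)) = 0 := by
    rw [app_idealQuotπ_app_of_comp_eq hq V, idealQuotπ_unit_app_eq_zero_iff _ hV]
    exact hcL
  obtain ⟨s, hs⟩ := exists_kernel_ι_app_eq q V _ h2
  refine ⟨s, ?_⟩
  apply kernel_ι_app_injective q' V
  rw [← comp_app_apply'', kernel.lift_ι, comp_app_apply'', hs, scalarMul_app_idealQuotπ_app γ _ _ μ₁ hμ₁ V, ← hc']
  exact congrArg _ hcc'

include hG hγ hq hq' hμ₁ in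
/-- **Multiplication by `g` is an isomorphism `𝓛/𝓛𝓘 ⥲ 𝓖𝓛/𝓖𝓛𝓘`** (`𝓖 = (g)`, `g` a non-zero-divisor on affine
opens) of `𝒪_X`-modules (mono + epi in the abelian category of `𝒪_X`-modules).
[cite: Lipman1969, Section 13 (p. 223)] -/
theorem isIso_kernel_map_scalarMul : IsIso (kernel.map q q' μ₁ μ₂ w) :=
  haveI := mono_kernel_map_scalarMul γ 𝓖 𝓛 𝓘 hG hγ q q' μ₁ hμ₁ μ₂ w
  haveI := epi_kernel_map_scalarMul γ 𝓖 𝓛 𝓘 hG q hq q' hq' μ₁ hμ₁ μ₂ w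
  isIso_of_mono_of_epi _

include hG hγ hq hq' hμ₁ w in
/-- **`ℓ_T Γ(X, 𝓖𝓛/𝓖𝓛𝓘) = ℓ_T Γ(X, 𝓛/𝓛𝓘)` and `ℓ_T Ȟ¹(𝒰, 𝓖𝓛/𝓖𝓛𝓘) = ℓ_T Ȟ¹(𝒰, 𝓛/𝓛𝓘)`**: the Euler
characteristic data of the kernel `K(𝓛;𝓘)` is unchanged under `𝓛 ↦ g𝓛` — Lipman's replacement of `E` by the
linearly equivalent `E + div(g)` in the computation of `(E·E)`, at the level of the sheaves `𝒪_E(−L)`.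
[cite: Lipman1969, Section 13 (p. 223) with Section 14 (p. 224)] -/
theorem length_kernel_scalarMul_eq {ι : Type u} (U : ι → X.Opens) :
    Module.length T (MSections π (kernel q') ⊤) = Module.length T (MSections π (kernel q) ⊤) ∧
      Module.length T (CechMH1 π (kernel q') U) = Module.length T (CechMH1 π (kernel q) U) := by
  haveI := isIso_kernel_map_scalarMul γ 𝓖 𝓛 𝓘 hG hγ q hq q' hq' μ₁ hμ₁ μ₂ w
  set e : kernel q ≅ kernel q' := asIso (kernel.map q q' μ₁ μ₂ w) with he
  refine ⟨(length_MSections_eq_of_iso π e ⊤).symm, ?_⟩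
  refine (LinearEquiv.length_eq (LinearEquiv.ofLinear (cechMapH1 π e.hom U) (cechMapH1 π e.inv U) ?_ ?_)).symm
  · apply LinearMap.ext
    intro x
    rw [LinearMap.comp_apply, ← cechMapH1_comp, e.inv_hom_id, cechMapH1_id_apply, LinearMap.id_apply]
  · apply LinearMap.ext
    intro x
    rw [LinearMap.comp_apply, ← cechMapH1_comp, e.hom_inv_id, cechMapH1_id_apply, LinearMap.id_apply]

end Iso

end Literature.AlgebraicGeometry.Resolution

end
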